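import Literature.AlgebraicGeometry.Motives.HodgeThetaSubalgebraUnitaryAdStableIdeal
import HarnessLib

/-!
# The Levi kernel ideal of the involution `ι = Θ − 2D` of a raising operator, and two consequences:
# a full Levi algebra on the larger side yields a RANK-ONE raising operator; the Levi algebra always has a
# non-zero raising operator of controlled rank (Ribet 1983 Thm. 3, Lie step — the «double Levi» route, part I)

Family `hodge`, layer `Literature/AlgebraicGeometry/Motives` (pure linear algebra over `ℂ`; no geometry). Research
context: cell `pub-hodge-ring2` (HONEST FRAMING: research route conditional on HC_CM; not a corollary; Q11.4-sentence-2
already refuted in dim ≥ 3), Literature lane gen 85, programme R70. UNCONDITIONAL; theorems only, no definition, no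
named fact (D-0026), no `sorry`. Sequel of `HodgeThetaSubalgebraUnitaryAdStableIdeal` (the `𝔰𝔩`-half of the ideal
structure of `𝔤𝔩`) and of the tree's Φ/Ψ raising-rank files, whose Levi instances it re-uses at ARBITRARY rank.

THE SETTING is that of the tree's unitary cores: `𝔊 ⊆ End_ℂ(W)` bracket-closed and irreducible, an involution `Θ ∈ 𝔊`
with eigenspaces `P`, `Q` (`dim P = a`, `dim Q = b`), a Hermitian pairing `s` with `P ⊥ Q`, definite on `P` and on `Q`,
for which `𝔊` is adjoint-closed. For ANY raising `B ∈ 𝔊` of rank `ρ` (adjoint `C`, Cayley–Hamilton projector pair `D`,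
`UnitaryThreeCoprime.exists_projector_pair`) the involution `ι = Θ − 2D ∈ 𝔊` is self-adjoint, commutes with `Θ`, and
`U⁻ = {ι = −1} = B(W) ⊕ (Q ∩ ker B)` (dimension `b`, `Θ`-type `(ρ | b − ρ)`), `U⁺ = {ι = 1} = (P ∩ ker C) ⊕ C(P)`
(dimension `a`, `Θ`-type `(a − ρ | ρ)`) — §1 `UnitaryLeviKernel.exists_involution`.

THE NEW OBJECT (§2). With `𝔷 = {Z ∈ 𝔊 : Zι = ιZ}`, the LEVI ALGEBRAS `L^∓ = 𝔷|_{U^∓}` and the LEVI KERNEL IDEALS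
`I⁻ = {Z|_{U⁻} : Z ∈ 𝔊, Z|_{U⁺} = 0}`, `I⁺` (symmetric): `dim I⁻ + dim L⁺ = dim 𝔷 = dim I⁺ + dim L⁻`
(`UnitaryLeviKernel.exists_kernel_levi`, Goursat's lemma in dimensions), and `I⁻` is `ad(End U⁻)`-stable as soon as
`L⁻ = End(U⁻)` (`UnitaryLeviKernel.kernel_adStable`: `[Z_A, Z]` kills `U⁺` because `Z_A` preserves it).

THE TWO CONSEQUENCES.
* §3 **`UnitaryLeviKernel.exists_raise_commute_ne_zero`** — for a raising `B` of rank `0 < ρ < a`, some NON-ZERO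
  raising operator of `𝔊` commutes with `ι` and has rank `≤ (a − ρ) + (b − ρ)` (the Levi algebra `L⁺` is irreducible on
  `U⁺` by `UnitaryTwoOdd.levi_irreducible`; if all raising parts of `𝔷` killed `C(P)`, then `C(P)` would be invariant).
* §4 **`UnitaryLeviKernel.exists_rankOne_raise_of_core`** — if `b > a`, `b ≥ 3`, and the abstract core of type
  `(ρ | b − ρ)` holds (hypothesis-schema `hcore`, literally that of `UnitaryRaisingRank.exists_raise_rank_gt`), then `𝔊`
  contains a raising operator of RANK ONE. Proof: `L⁻ = End(U⁻)` (`UnitaryThreeCoprime.levi_instance`), so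
  `dim I⁻ = dim 𝔷 − dim L⁺ ≥ b² − a² ≥ 3`, `I⁻` contains a non-scalar operator, hence (`UnitaryAdStable.smulRight_mem`)
  every `u ⊗ α` with `α(u) = 0` — in particular `u ∈ B(W)`, `α` a `Q ∩ ker B`-coordinate; its zero extension to `W` is a
  rank-one raising operator in `𝔊`. (This is the first rank-LOWERING device of the lane; at maximal rank the Φ-route
  used the same Levi algebra to raise the rank.)
The sequel `HodgeThetaSubalgebraUnitaryRankOneRaise` turns a rank-one raising operator into `𝔊 = End(W)` when `a ≠ b`.

## References
* [Ribet1983] K. A. Ribet, *Hodge classes on certain types of abelian varieties*, Amer. J. Math. 105 (1983), Thm. 3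
  (= [Gordon1997, Thm. 6.3 (3)], held `paper:arxiv-alg-geom_9709030` pp. 18–19: «it is here that the relative primality
  of n′ and n″ is required» — Serre's lemma, replaced here by linear algebra of the Levi centraliser).
* [Deligne1982HodgeCycles] P. Deligne, *Hodge cycles on abelian varieties*, LNM 900 (1982), I §3 Prop. 3.4, 3.6.
* [GoodmanWallachGTM255] R. Goodman, N. R. Wallach, GTM 255 (2009), §4.1.1 (gradings, centralisers of involutions).
* [Humphreys1972] J. E. Humphreys, *Introduction to Lie Algebras and Representation Theory*, §19.1, §4.1.
* [HoffmanKunze1971LinearAlgebra] K. Hoffman, R. Kunze, *Linear Algebra* (1971), §6.7 (projections), §3.5–3.6.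
-/

noncomputable section

open Module

namespace Literature.AlgebraicGeometry.Motives

namespace HodgeStructure

universe u

variable {W : Type u} [AddCommGroup W] [Module ℂ W]

/-! ### §1 The involution `ι = Θ − 2D` of a raising operator -/

/-- **The involution of a raising operator.** For a raising `B ∈ 𝔊` with `s`-adjoint `C` and Cayley–Hamilton projector
pair `D` (`UnitaryThreeCoprime.exists_projector_pair`), `ι = Θ − 2D ∈ 𝔊` is an `s`-self-adjoint involution commuting
with `Θ`; `{ι = −1} = B(W) ⊕ (Q ∩ ker B)`, `{ι = 1} = (P ∩ ker C) ⊕ C(P)`, with `dim B(W) = dim C(P) = ρ`,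
`dim (P ∩ ker C) = dim P − ρ`, `dim (Q ∩ ker B) = dim Q − ρ`.
[cite: Deligne1982HodgeCycles, I §3 (proof of Prop. 3.6)] [cite: GoodmanWallachGTM255, §4.1.1]
[cite: HoffmanKunze1971LinearAlgebra, §6.7] -/
theorem UnitaryLeviKernel.exists_involution [FiniteDimensional ℂ W] {𝔊 : Submodule ℂ (Module.End ℂ W)}
    (hbr : ∀ Y ∈ 𝔊, ∀ Z ∈ 𝔊, Y * Z - Z * Y ∈ 𝔊)
    {Θ : Module.End ℂ W} (hΘ : Θ ∈ 𝔊) (hΘΘ : Θ * Θ = 1)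
    {P Q : Submodule ℂ W} (hP : ∀ x, x ∈ P ↔ Θ x = x) (hQ : ∀ x, x ∈ Q ↔ Θ x = -x)
    {s : W → W → ℂ} (hadd : ∀ x y z, s (x + y) z = s x z + s y z) (hsymm : ∀ x y, s y x = starRingEnd ℂ (s x y))
    (hPQ : ∀ p ∈ P, ∀ q ∈ Q, s p q = 0) (hdefP : ∀ p ∈ P, s p p = 0 → p = 0) (hdefQ : ∀ q ∈ Q, s q q = 0 → q = 0)
    (hadj : ∀ X ∈ 𝔊, ∃ Y ∈ 𝔊, ∀ x y, s (X x) y = s x (Y y))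
    {B : Module.End ℂ W} (hB : B ∈ 𝔊) (hΘB : Θ * B = B) (hBΘ : B * Θ = -B) :
    ∃ C ∈ 𝔊, ∃ ι ∈ 𝔊, (∀ x y, s (B x) y = s x (C y)) ∧ Θ * C = -C ∧ C * Θ = C ∧
      ι * ι = 1 ∧ ι * Θ = Θ * ι ∧ (∀ x y, s (ι x) y = s x (ι y)) ∧
      (∀ x ∈ LinearMap.range B, ι x = -x) ∧ (∀ x ∈ Q ⊓ LinearMap.ker B, ι x = -x) ∧
      (∀ x ∈ P ⊓ LinearMap.ker C, ι x = x) ∧ (∀ x ∈ P.map C, ι x = x) ∧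
      (∀ x, ι x = -x → Θ x = x → x ∈ LinearMap.range B) ∧ (∀ x, ι x = -x → Θ x = -x → x ∈ Q ⊓ LinearMap.ker B) ∧
      (∀ x, ι x = x → Θ x = x → x ∈ P ⊓ LinearMap.ker C) ∧ (∀ x, ι x = x → Θ x = -x → x ∈ P.map C) ∧
      Module.finrank ℂ (LinearMap.range B) + Module.finrank ℂ ↥(P ⊓ LinearMap.ker C) = Module.finrank ℂ P ∧
      Module.finrank ℂ ↥(Q ⊓ LinearMap.ker B) + Module.finrank ℂ (LinearMap.range B) = Module.finrank ℂ Q ∧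
      Module.finrank ℂ ↥(P.map C) = Module.finrank ℂ (LinearMap.range B) ∧
      LinearMap.range B ≤ P ∧ P.map C ≤ Q ∧
      Module.finrank ℂ ↥(LinearMap.ker (ι + 1)) = Module.finrank ℂ Q ∧
      Module.finrank ℂ ↥(LinearMap.ker (ι - 1)) = Module.finrank ℂ P := by
  classical
  obtain ⟨haddr, h0r, h0l, hnegr, hnegl, hsubr, hsubl⟩ := UnitaryTwoOdd.herm_right hadd hsymm
  have hΘΘv : ∀ v, Θ (Θ v) = v := fun v => by rw [← Module.End.mul_apply, hΘΘ, Module.End.one_apply]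
  have hPhat : ∀ w, (2 : ℂ)⁻¹ • (w + Θ w) ∈ P := fun w => (hP _).2 (by rw [map_smul, map_add, hΘΘv, add_comm])
  have hQhat : ∀ w, (2 : ℂ)⁻¹ • (w - Θ w) ∈ Q := fun w =>
    (hQ _).2 (by rw [map_smul, map_sub, hΘΘv, ← smul_neg, neg_sub])
  have hsplitΘ : ∀ w, (2 : ℂ)⁻¹ • (w + Θ w) + (2 : ℂ)⁻¹ • (w - Θ w) = w := fun w => by module
  have hraiseval : ∀ Z : Module.End ℂ W, Θ * Z = Z → ∀ w, Z w ∈ P := fun Z hΘZ w =>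
    (hP _).2 (by rw [← Module.End.mul_apply, hΘZ])
  have hΘs := UnitaryTwoOdd.theta_selfAdjoint hadd hsymm hΘΘ hP hQ hPQ
  have hBmem : ∀ w, B w ∈ P := hraiseval B hΘB
  have hrangeP : LinearMap.range B ≤ P := by rintro _ ⟨w, rfl⟩; exact hBmem w
  obtain ⟨C, hC, hBC⟩ := hadj B hB
  obtain ⟨hΘC, hCΘ⟩ := UnitaryTwoOdd.lower_of_adjoint hadd hsymm hΘΘ hP hQ hPQ hdefP hdefQ hΘB hBΘ hBC
  have hCmem : ∀ w, C w ∈ Q := fun w => (hQ _).2 (by rw [← Module.End.mul_apply, hΘC, LinearMap.neg_apply])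
  obtain ⟨D, hD, hDΘ, hD1, hD2, hD3, hD4, hD5, hD6, hpos1, hpos2, hdec, hDs⟩ :=
    UnitaryThreeCoprime.exists_projector_pair hbr hΘΘ hP hQ hadd hsymm hPQ hdefP hdefQ hB hC hΘB hBΘ hBC
  have hDfix : ∀ x ∈ LinearMap.range B, D x = x := by rintro _ ⟨w, rfl⟩; exact hD1 w
  have hCinjR : ∀ x ∈ LinearMap.range B, C x = 0 → x = 0 := by rintro _ ⟨w, rfl⟩ h; exact hpos2 w h
  have hCD : ∀ p ∈ P, C p = C (D p) := fun p hp => by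
    have h := (hD5 p hp).2; rw [map_sub, sub_eq_zero] at h; exact h
  -- the involution
  set ι : Module.End ℂ W := Θ - (2 : ℂ) • D with hιdef
  have hιmem : ι ∈ 𝔊 := Submodule.sub_mem _ hΘ (Submodule.smul_mem _ _ hD)
  have hιapply : ∀ w, ι w = Θ w - (D w + D w) := fun w => by
    rw [hιdef, LinearMap.sub_apply, LinearMap.smul_apply, two_smul]
  have hιa : ∀ a ∈ LinearMap.range B, ι a = -a := fun a ha => by
    rw [hιapply, hDfix a ha, (hP a).1 (hrangeP ha)]; abel
  have hιb : ∀ b ∈ P ⊓ LinearMap.ker C, ι b = b := fun b hb => by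
    obtain ⟨hbP, hbC⟩ := Submodule.mem_inf.1 hb
    rw [hιapply, hD2 b hbP (LinearMap.mem_ker.1 hbC), (hP b).1 hbP]; abel
  have hιc : ∀ c ∈ P.map C, ι c = c := fun c hc => by
    obtain ⟨p, hp, rfl⟩ := hc
    rw [hιapply, hD3 p hp, (hQ _).1 (hCmem p)]; abel
  have hιd : ∀ d ∈ Q ⊓ LinearMap.ker B, ι d = -d := fun d hd => by
    obtain ⟨hdQ, hdB⟩ := Submodule.mem_inf.1 hd
    rw [hιapply, hD4 d hdQ (LinearMap.mem_ker.1 hdB), (hQ d).1 hdQ]; abel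
  have hιι : ι * ι = 1 := by
    refine LinearMap.ext fun w => ?_
    obtain ⟨a, ha, b, hb, c, hc, d, hd, rfl⟩ := hdec w
    have h1 : ι (a + b + c + d) = -a + b + c - d := by
      rw [map_add, map_add, map_add, hιa a ha, hιb b hb, hιc c hc, hιd d hd]; abel
    have h2 : ι (-a + b + c - d) = a + b + c + d := by
      rw [map_sub, map_add, map_add, map_neg, hιa a ha, hιb b hb, hιc c hc, hιd d hd]; abel
    rw [Module.End.mul_apply, Module.End.one_apply, h1, h2]
  have hιΘ : ι * Θ = Θ * ι := by
    rw [hιdef, sub_mul, mul_sub, smul_mul_assoc, mul_smul_comm, hDΘ, hΘΘ]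
  have hιs : ∀ x y, s (ι x) y = s x (ι y) := fun x y => by
    rw [hιapply, hιapply, hsubl, hadd, hsubr, haddr, hDs, hΘs]
  -- membership in the four pieces from the eigenvalues of `ι` and `Θ`
  have hΘa : ∀ a ∈ LinearMap.range B, Θ a = a := fun a ha => (hP a).1 (hrangeP ha)
  have hΘb : ∀ b ∈ P ⊓ LinearMap.ker C, Θ b = b := fun b hb => (hP b).1 (Submodule.mem_inf.1 hb).1
  have hΘc : ∀ c ∈ P.map C, Θ c = -c := fun c hc => by
    obtain ⟨p, -, rfl⟩ := hc; exact (hQ _).1 (hCmem p)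
  have hΘd : ∀ d ∈ Q ⊓ LinearMap.ker B, Θ d = -d := fun d hd => (hQ d).1 (Submodule.mem_inf.1 hd).1
  have htwo : ∀ x : W, x + x = 0 → x = 0 := fun x hx => by
    rw [← two_smul ℂ] at hx; exact (smul_eq_zero.1 hx).resolve_left two_ne_zero
  have hpieces : ∀ w, ∀ ε₁ ε₂ : ℂ, ι w = ε₁ • w → Θ w = ε₂ • w →
      ∃ a ∈ LinearMap.range B, ∃ b ∈ P ⊓ LinearMap.ker C, ∃ c ∈ P.map C, ∃ d ∈ Q ⊓ LinearMap.ker B,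
        w = a + b + c + d ∧ (ε₁ + 1) • a = 0 ∧ (ε₁ - 1) • b = 0 ∧ (ε₁ - 1) • c = 0 ∧ (ε₁ + 1) • d = 0 ∧
          (ε₂ - 1) • a = 0 ∧ (ε₂ - 1) • b = 0 ∧ (ε₂ + 1) • c = 0 ∧ (ε₂ + 1) • d = 0 := by
    intro w ε₁ ε₂ h1 h2
    obtain ⟨a, ha, b, hb, c, hc, d, hd, hw⟩ := hdec w
    refine ⟨a, ha, b, hb, c, hc, d, hd, hw, ?_⟩
    have hι' : ι w = -a + b + c - d := by
      rw [hw, map_add, map_add, map_add, hιa a ha, hιb b hb, hιc c hc, hιd d hd]; abel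
    have hΘ' : Θ w = a + b - c - d := by
      rw [hw, map_add, map_add, map_add, hΘa a ha, hΘb b hb, hΘc c hc, hΘd d hd]; abel
    -- independence of the four pieces: project with `ι` and `Θ`
    have key : ∀ (x y z t : W), x ∈ LinearMap.range B → y ∈ P ⊓ LinearMap.ker C → z ∈ P.map C →
        t ∈ Q ⊓ LinearMap.ker B → x + y + z + t = 0 → x = 0 ∧ y = 0 ∧ z = 0 ∧ t = 0 := by
      intro x y z t hx hy hz ht hsum
      have hPsum : x + y = 0 ∧ z + t = 0 := by
        have hp : x + y ∈ P := Submodule.add_mem _ (hrangeP hx) (Submodule.mem_inf.1 hy).1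
        have hq : z + t ∈ Q := by
          refine Submodule.add_mem _ ?_ (Submodule.mem_inf.1 ht).1
          obtain ⟨p, -, rfl⟩ := hz; exact hCmem p
        have h : x + y = -(z + t) := by rw [eq_neg_iff_add_eq_zero, ← hsum]; abel
        have hp' : x + y ∈ P ⊓ Q := Submodule.mem_inf.2 ⟨hp, by rw [h]; exact Submodule.neg_mem _ hq⟩
        have hPQbot : ∀ v ∈ P ⊓ Q, v = 0 := fun v hv => by
          obtain ⟨hvP, hvQ⟩ := Submodule.mem_inf.1 hv
          have e1 := (hP v).1 hvP; have e2 := (hQ v).1 hvQ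
          rw [e1] at e2
          exact htwo v (by rw [eq_neg_iff_add_eq_zero] at e2; exact e2)
        have hxy := hPQbot _ hp'
        refine ⟨hxy, ?_⟩
        rw [hxy, zero_add] at hsum
        exact hsum
      obtain ⟨hxy, hzt⟩ := hPsum
      have hx0 : x = 0 := by
        have hyx : y = -x := eq_neg_of_add_eq_zero_right hxy
        obtain ⟨hyP, hyC⟩ := Submodule.mem_inf.1 hy
        have hCx : C x = 0 := by
          have := LinearMap.mem_ker.1 hyC; rwa [hyx, map_neg, neg_eq_zero] at this
        exact hCinjR x hx hCx
      have hy0 : y = 0 := by rw [hx0, zero_add] at hxy; exact hxy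
      have ht0 : t = 0 := by
        have hzt' : z = -t := eq_neg_of_add_eq_zero_left hzt
        obtain ⟨p, hp, hpz⟩ := hz
        obtain ⟨htQ, htB⟩ := Submodule.mem_inf.1 ht
        have hBz : B z = 0 := by rw [hzt', map_neg, LinearMap.mem_ker.1 htB, neg_zero]
        have hCp : C p = 0 := hpos1 p hp (by rw [hpz]; exact hBz)
        have hz0 : z = 0 := by rw [← hpz, hCp]
        rw [hz0, zero_add] at hzt; exact hzt
      have hz0 : z = 0 := by rw [ht0, add_zero] at hzt; exact hzt
      exact ⟨hx0, hy0, hz0, ht0⟩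
    have e1 : (ε₁ + 1) • a + (ε₁ - 1) • b + (ε₁ - 1) • c + (ε₁ + 1) • d = 0 := by
      have h := h1; rw [hι', hw, smul_add, smul_add, smul_add] at h
      have : (ε₁ + 1) • a + (ε₁ - 1) • b + (ε₁ - 1) • c + (ε₁ + 1) • d =
          (ε₁ • a + ε₁ • b + ε₁ • c + ε₁ • d) - (-a + b + c - d) := by module
      rw [this, ← h, sub_self]
    have e2 : (ε₂ - 1) • a + (ε₂ - 1) • b + (ε₂ + 1) • c + (ε₂ + 1) • d = 0 := by
      have h := h2; rw [hΘ', hw, smul_add, smul_add, smul_add] at h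
      have : (ε₂ - 1) • a + (ε₂ - 1) • b + (ε₂ + 1) • c + (ε₂ + 1) • d =
          (ε₂ • a + ε₂ • b + ε₂ • c + ε₂ • d) - (a + b - c - d) := by module
      rw [this, ← h, sub_self]
    obtain ⟨f1, f2, f3, f4⟩ := key _ _ _ _ (Submodule.smul_mem _ _ ha) (Submodule.smul_mem _ _ hb)
      (Submodule.smul_mem _ _ hc) (Submodule.smul_mem _ _ hd) e1
    obtain ⟨g1, g2, g3, g4⟩ := key _ _ _ _ (Submodule.smul_mem _ _ ha) (Submodule.smul_mem _ _ hb)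
      (Submodule.smul_mem _ _ hc) (Submodule.smul_mem _ _ hd) e2
    exact ⟨f1, f2, f3, f4, g1, g2, g3, g4⟩
  have hne2 : (-1 : ℂ) - 1 ≠ 0 := by norm_num
  have hne2' : (1 : ℂ) + 1 ≠ 0 := by norm_num
  have hmemA : ∀ x, ι x = -x → Θ x = x → x ∈ LinearMap.range B := fun x h1 h2 => by
    obtain ⟨a, ha, b, hb, c, hc, d, hd, hw, -, f2, f3, -, -, -, g3, g4⟩ :=
      hpieces x (-1) 1 (by rw [h1, neg_one_smul]) (by rw [h2, one_smul])
    have hb0 : b = 0 := (smul_eq_zero.1 f2).resolve_left hne2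
    have hc0 : c = 0 := (smul_eq_zero.1 f3).resolve_left hne2
    have hd0 : d = 0 := (smul_eq_zero.1 g4).resolve_left hne2'
    rw [hw, hb0, hc0, hd0, add_zero, add_zero, add_zero]; exact ha
  have hmemD : ∀ x, ι x = -x → Θ x = -x → x ∈ Q ⊓ LinearMap.ker B := fun x h1 h2 => by
    obtain ⟨a, ha, b, hb, c, hc, d, hd, hw, -, f2, f3, -, g1, g2, -, -⟩ :=
      hpieces x (-1) (-1) (by rw [h1, neg_one_smul]) (by rw [h2, neg_one_smul])
    have hb0 : b = 0 := (smul_eq_zero.1 f2).resolve_left hne2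
    have hc0 : c = 0 := (smul_eq_zero.1 f3).resolve_left hne2
    have ha0 : a = 0 := (smul_eq_zero.1 g1).resolve_left hne2
    rw [hw, ha0, hb0, hc0, zero_add, add_zero, zero_add]; exact hd
  have hmemB : ∀ x, ι x = x → Θ x = x → x ∈ P ⊓ LinearMap.ker C := fun x h1 h2 => by
    obtain ⟨a, ha, b, hb, c, hc, d, hd, hw, f1, -, -, f4, -, -, g3, g4⟩ :=
      hpieces x 1 1 (by rw [h1, one_smul]) (by rw [h2, one_smul])
    have ha0 : a = 0 := (smul_eq_zero.1 f1).resolve_left hne2'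
    have hd0 : d = 0 := (smul_eq_zero.1 f4).resolve_left hne2'
    have hc0 : c = 0 := (smul_eq_zero.1 g3).resolve_left hne2'
    rw [hw, ha0, hc0, hd0, zero_add, add_zero, add_zero]; exact hb
  have hmemC : ∀ x, ι x = x → Θ x = -x → x ∈ P.map C := fun x h1 h2 => by
    obtain ⟨a, ha, b, hb, c, hc, d, hd, hw, f1, -, -, f4, g1, g2, -, -⟩ :=
      hpieces x 1 (-1) (by rw [h1, one_smul]) (by rw [h2, neg_one_smul])
    have ha0 : a = 0 := (smul_eq_zero.1 f1).resolve_left hne2'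
    have hd0 : d = 0 := (smul_eq_zero.1 f4).resolve_left hne2'
    have hb0 : b = 0 := (smul_eq_zero.1 g2).resolve_left hne2
    rw [hw, ha0, hb0, hd0, zero_add, zero_add, add_zero]; exact hc
  -- dimensions
  have hfinP₀ : Module.finrank ℂ (LinearMap.range B) + Module.finrank ℂ ↥(P ⊓ LinearMap.ker C) =
      Module.finrank ℂ P := by
    have hsup : LinearMap.range B ⊔ (P ⊓ LinearMap.ker C) = P := by
      apply le_antisymm (sup_le hrangeP inf_le_left)
      intro p hp
      obtain ⟨hDp, hCp⟩ := hD5 p hp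
      have h : p = D p + (p - D p) := by abel
      rw [h]
      exact Submodule.add_mem _ (Submodule.mem_sup_left hDp) (Submodule.mem_sup_right (Submodule.mem_inf.2
        ⟨Submodule.sub_mem _ hp (hrangeP hDp), LinearMap.mem_ker.2 hCp⟩))
    have hinf : LinearMap.range B ⊓ (P ⊓ LinearMap.ker C) = ⊥ := by
      rw [eq_bot_iff]
      rintro x ⟨hxr, ⟨-, hxC⟩⟩
      rw [Submodule.mem_bot]
      exact hCinjR x hxr (LinearMap.mem_ker.1 hxC)
    have h := Submodule.finrank_sup_add_finrank_inf_eq (LinearMap.range B) (P ⊓ LinearMap.ker C)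
    rw [hsup, hinf, finrank_bot, add_zero] at h
    exact h.symm
  set gC : ↥(LinearMap.range B) →ₗ[ℂ] W := C ∘ₗ (LinearMap.range B).subtype with hgCdef
  have hgCinj : Function.Injective gC := by
    intro x y hxy
    apply Subtype.ext
    have h : C ((x : W) - y) = 0 := by rw [map_sub, sub_eq_zero]; exact hxy
    exact sub_eq_zero.1 (hCinjR _ (Submodule.sub_mem _ x.2 y.2) h)
  have hmapC : P.map C = LinearMap.range gC := by
    apply le_antisymm
    · rintro _ ⟨p, hp, rfl⟩
      exact ⟨⟨D p, (hD5 p hp).1⟩, by rw [hgCdef, LinearMap.comp_apply, Submodule.subtype_apply, ← hCD p hp]⟩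
    · rintro _ ⟨x, rfl⟩
      exact ⟨x, hrangeP x.2, rfl⟩
  have hfinQU : Module.finrank ℂ ↥(P.map C) = Module.finrank ℂ (LinearMap.range B) := by
    rw [hmapC, LinearMap.finrank_range_of_inj hgCinj]
  have hfinQ₀ : Module.finrank ℂ ↥(Q ⊓ LinearMap.ker B) + Module.finrank ℂ (LinearMap.range B) =
      Module.finrank ℂ Q := by
    have hsup : (Q ⊓ LinearMap.ker B) ⊔ P.map C = Q := by
      apply le_antisymm (sup_le inf_le_left (by rintro _ ⟨p, hp, rfl⟩; exact hCmem p))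
      intro q hq
      obtain ⟨hDq, hBq⟩ := hD6 q hq
      have h : q = (q + D q) + (-(D q)) := by abel
      rw [h]
      refine Submodule.add_mem _ (Submodule.mem_sup_left (Submodule.mem_inf.2 ⟨Submodule.add_mem _ hq ?_,
        LinearMap.mem_ker.2 hBq⟩)) (Submodule.mem_sup_right (Submodule.neg_mem _ hDq))
      obtain ⟨p, hp, hpq⟩ := hDq
      rw [← hpq]; exact hCmem p
    have hinf : (Q ⊓ LinearMap.ker B) ⊓ P.map C = ⊥ := by
      rw [eq_bot_iff]
      rintro x ⟨⟨-, hxB⟩, ⟨p, hp, rfl⟩⟩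
      rw [Submodule.mem_bot]
      exact hpos1 p hp (LinearMap.mem_ker.1 hxB)
    have h := Submodule.finrank_sup_add_finrank_inf_eq (Q ⊓ LinearMap.ker B) (P.map C)
    rw [hsup, hinf, finrank_bot, add_zero, hfinQU] at h
    exact h.symm
  have hmapCQ : P.map C ≤ Q := by rintro _ ⟨p, -, rfl⟩; exact hCmem p
  -- dimensions of the eigenspaces of `ι`
  have hιΘv : ∀ w, ι (Θ w) = Θ (ι w) := fun w => by rw [← Module.End.mul_apply, hιΘ, Module.End.mul_apply]
  have hPQbot : P ⊓ Q = ⊥ := by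
    rw [eq_bot_iff]
    intro v hv
    obtain ⟨hvP, hvQ⟩ := Submodule.mem_inf.1 hv
    rw [Submodule.mem_bot]
    have e1 := (hP v).1 hvP; have e2 := (hQ v).1 hvQ
    rw [e1] at e2
    exact htwo v (by rw [eq_neg_iff_add_eq_zero] at e2; exact e2)
  have hfinUm : Module.finrank ℂ ↥(LinearMap.ker (ι + 1)) = Module.finrank ℂ Q := by
    have hmem : ∀ x, x ∈ LinearMap.ker (ι + 1) ↔ ι x = -x := fun x => by
      rw [LinearMap.mem_ker, LinearMap.add_apply, Module.End.one_apply, add_eq_zero_iff_eq_neg]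
    have hsup : LinearMap.range B ⊔ (Q ⊓ LinearMap.ker B) = LinearMap.ker (ι + 1) := by
      apply le_antisymm (sup_le (fun a ha => (hmem a).2 (hιa a ha)) (fun d hd => (hmem d).2 (hιd d hd)))
      intro x hx
      have hιx := (hmem x).1 hx
      have h1 : ι ((2 : ℂ)⁻¹ • (x + Θ x)) = -((2 : ℂ)⁻¹ • (x + Θ x)) := by
        rw [map_smul, map_add, hιΘv, hιx, map_neg, ← smul_neg, neg_add]
      have h2 : ι ((2 : ℂ)⁻¹ • (x - Θ x)) = -((2 : ℂ)⁻¹ • (x - Θ x)) := by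
        rw [map_smul, map_sub, hιΘv, hιx, map_neg, ← smul_neg, neg_sub', sub_neg_eq_add, neg_add_eq_sub]
      rw [← hsplitΘ x]
      exact Submodule.add_mem _ (Submodule.mem_sup_left (hmemA _ h1 ((hP _).1 (hPhat x))))
        (Submodule.mem_sup_right (hmemD _ h2 ((hQ _).1 (hQhat x))))
    have hinf : LinearMap.range B ⊓ (Q ⊓ LinearMap.ker B) = ⊥ := by
      rw [eq_bot_iff, ← hPQbot]
      exact fun x hx => Submodule.mem_inf.2 ⟨hrangeP hx.1, (Submodule.mem_inf.1 hx.2).1⟩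
    have h := Submodule.finrank_sup_add_finrank_inf_eq (LinearMap.range B) (Q ⊓ LinearMap.ker B)
    rw [hsup, hinf, finrank_bot, add_zero] at h
    rw [h, add_comm, hfinQ₀]
  have hfinUp : Module.finrank ℂ ↥(LinearMap.ker (ι - 1)) = Module.finrank ℂ P := by
    have hmem : ∀ x, x ∈ LinearMap.ker (ι - 1) ↔ ι x = x := fun x => by
      rw [LinearMap.mem_ker, LinearMap.sub_apply, Module.End.one_apply, sub_eq_zero]
    have hsup : (P ⊓ LinearMap.ker C) ⊔ P.map C = LinearMap.ker (ι - 1) := by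
      apply le_antisymm (sup_le (fun b hb => (hmem b).2 (hιb b hb)) (fun c hc => (hmem c).2 (hιc c hc)))
      intro x hx
      have hιx := (hmem x).1 hx
      have h1 : ι ((2 : ℂ)⁻¹ • (x + Θ x)) = (2 : ℂ)⁻¹ • (x + Θ x) := by
        rw [map_smul, map_add, hιΘv, hιx]
      have h2 : ι ((2 : ℂ)⁻¹ • (x - Θ x)) = (2 : ℂ)⁻¹ • (x - Θ x) := by
        rw [map_smul, map_sub, hιΘv, hιx]
      rw [← hsplitΘ x]
      exact Submodule.add_mem _ (Submodule.mem_sup_left (hmemB _ h1 ((hP _).1 (hPhat x))))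
        (Submodule.mem_sup_right (hmemC _ h2 ((hQ _).1 (hQhat x))))
    have hinf : (P ⊓ LinearMap.ker C) ⊓ P.map C = ⊥ := by
      rw [eq_bot_iff, ← hPQbot]
      exact fun x hx => Submodule.mem_inf.2 ⟨(Submodule.mem_inf.1 hx.1).1, hmapCQ hx.2⟩
    have h := Submodule.finrank_sup_add_finrank_inf_eq (P ⊓ LinearMap.ker C) (P.map C)
    rw [hsup, hinf, finrank_bot, add_zero] at h
    rw [h, hfinQU, add_comm, hfinP₀]
  exact ⟨C, hC, ι, hιmem, hBC, hΘC, hCΘ, hιι, hιΘ, hιs, hιa, hιd, hιb, hιc, hmemA, hmemD, hmemB, hmemC, hfinP₀, hfinQ₀,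
    hfinQU, hrangeP, hmapCQ, hfinUm, hfinUp⟩

/-! ### §2 The Levi algebras and the Levi kernel ideals of an involution `ι ∈ End(W)` -/

/-- Rank–nullity in the form `dim f(p) + dim (p ∩ ker f) = dim p`. [cite: HoffmanKunze1971LinearAlgebra, §3.1 Thm. 2] -/
theorem UnitaryLeviKernel.finrank_map_add_finrank_inf_ker {M N : Type*} [AddCommGroup M] [Module ℂ M]
    [FiniteDimensional ℂ M] [AddCommGroup N] [Module ℂ N] (f : M →ₗ[ℂ] N) (p : Submodule ℂ M) :
    Module.finrank ℂ (p.map f) + Module.finrank ℂ ↥(p ⊓ LinearMap.ker f) = Module.finrank ℂ p := by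
  have h := LinearMap.finrank_range_add_finrank_ker (f.domRestrict p)
  rw [LinearMap.range_domRestrict] at h
  rw [← h]
  congr 1
  have : LinearMap.ker (f.domRestrict p) = (p ⊓ LinearMap.ker f).comap p.subtype := by
    ext x; simp [LinearMap.mem_ker, LinearMap.domRestrict_apply]
  rw [this, (Submodule.comapSubtypeEquivOfLe (inf_le_left : p ⊓ LinearMap.ker f ≤ p)).finrank_eq]

/-- **The Levi algebras `L^∓` and the Levi kernel ideals `I^∓` of an involution `ι`, and Goursat's dimension identity
`dim I⁻ + dim L⁺ = dim I⁺ + dim L⁻` (both sides equal `dim {Z ∈ 𝔊 : Zι = ιZ}`).** Here `U⁻ = {ι = −1}`, `U⁺ = {ι = 1}`,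
`L^∓ = {Z|_{U^∓} : Z ∈ 𝔊, Zι = ιZ}`, `I^∓ = {Z|_{U^∓} : Z ∈ 𝔊, Z|_{U^±} = 0}` (such `Z` commute with `ι` automatically).
[cite: GoodmanWallachGTM255, §4.1.1] [cite: Humphreys1972, §19.1] [cite: HoffmanKunze1971LinearAlgebra, §6.7] -/
theorem UnitaryLeviKernel.exists_kernel_levi [FiniteDimensional ℂ W] (𝔊 : Submodule ℂ (Module.End ℂ W))
    {ι : Module.End ℂ W} (hιι : ι * ι = 1)
    {Um Up : Submodule ℂ W} (hUm : ∀ x, x ∈ Um ↔ ι x = -x) (hUp : ∀ x, x ∈ Up ↔ ι x = x) :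
    ∃ (Im : Submodule ℂ (Module.End ℂ Um)) (Ip : Submodule ℂ (Module.End ℂ Up))
      (Lm : Submodule ℂ (Module.End ℂ Um)) (Lp : Submodule ℂ (Module.End ℂ Up)),
      (∀ T, T ∈ Im ↔ ∃ Z ∈ 𝔊, (∀ x : Um, ((T x : Um) : W) = Z x) ∧ ∀ y ∈ Up, Z y = 0) ∧
      (∀ T, T ∈ Ip ↔ ∃ Z ∈ 𝔊, (∀ x : Up, ((T x : Up) : W) = Z x) ∧ ∀ y ∈ Um, Z y = 0) ∧
      (∀ T, T ∈ Lm ↔ ∃ Z ∈ 𝔊, Z * ι = ι * Z ∧ ∀ x : Um, ((T x : Um) : W) = Z x) ∧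
      (∀ T, T ∈ Lp ↔ ∃ Z ∈ 𝔊, Z * ι = ι * Z ∧ ∀ x : Up, ((T x : Up) : W) = Z x) ∧
      Module.finrank ℂ Im + Module.finrank ℂ Lp = Module.finrank ℂ Ip + Module.finrank ℂ Lm := by
  classical
  have hιv : ∀ v, ι (ι v) = v := fun v => by rw [← Module.End.mul_apply, hιι, Module.End.one_apply]
  -- the two projections
  have hmemm : ∀ w, ((2 : ℂ)⁻¹ • (1 - ι)) w ∈ Um := fun w => (hUm _).2 (by
    simp only [LinearMap.smul_apply, LinearMap.sub_apply, Module.End.one_apply, map_smul, map_sub, hιv]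
    module)
  have hmemp : ∀ w, ((2 : ℂ)⁻¹ • (1 + ι)) w ∈ Up := fun w => (hUp _).2 (by
    simp only [LinearMap.smul_apply, LinearMap.add_apply, Module.End.one_apply, map_smul, map_add, hιv]
    module)
  set πm : W →ₗ[ℂ] Um := LinearMap.codRestrict Um ((2 : ℂ)⁻¹ • (1 - ι)) hmemm with hπmdef
  set πp : W →ₗ[ℂ] Up := LinearMap.codRestrict Up ((2 : ℂ)⁻¹ • (1 + ι)) hmemp with hπpdef
  have hπmval : ∀ w, (πm w : W) = (2 : ℂ)⁻¹ • (w - ι w) := fun w => by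
    rw [hπmdef, LinearMap.codRestrict_apply, LinearMap.smul_apply, LinearMap.sub_apply, Module.End.one_apply]
  have hπpval : ∀ w, (πp w : W) = (2 : ℂ)⁻¹ • (w + ι w) := fun w => by
    rw [hπpdef, LinearMap.codRestrict_apply, LinearMap.smul_apply, LinearMap.add_apply, Module.End.one_apply]
  have hπm_id : ∀ x : Um, πm x = x := fun x => Subtype.ext (by rw [hπmval, (hUm x).1 x.2]; module)
  have hπp_id : ∀ x : Up, πp x = x := fun x => Subtype.ext (by rw [hπpval, (hUp x).1 x.2]; module)
  have hπm_zero : ∀ y ∈ Up, πm y = 0 := fun y hy => Subtype.ext (by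
    rw [hπmval, (hUp y).1 hy, sub_self, smul_zero, Submodule.coe_zero])
  have hπp_zero : ∀ y ∈ Um, πp y = 0 := fun y hy => Subtype.ext (by
    rw [hπpval, (hUm y).1 hy, add_neg_cancel, smul_zero, Submodule.coe_zero])
  have hsplit : ∀ w, (πm w : W) + (πp w : W) = w := fun w => by rw [hπmval, hπpval]; module
  -- the two restriction maps, linear on all of `End W`
  set ρm : Module.End ℂ W →ₗ[ℂ] Module.End ℂ Um :=
    { toFun := fun Z => πm ∘ₗ Z ∘ₗ Um.subtype
      map_add' := fun Z Z' => by ext x; simp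
      map_smul' := fun c Z => by ext x; simp } with hρmdef
  set ρp : Module.End ℂ W →ₗ[ℂ] Module.End ℂ Up :=
    { toFun := fun Z => πp ∘ₗ Z ∘ₗ Up.subtype
      map_add' := fun Z Z' => by ext x; simp
      map_smul' := fun c Z => by ext x; simp } with hρpdef
  have hρm : ∀ Z (x : Um), ρm Z x = πm (Z x) := fun Z x => rfl
  have hρp : ∀ Z (x : Up), ρp Z x = πp (Z x) := fun Z x => rfl
  -- commuting operators preserve the eigenspaces
  have hcm : ∀ Z : Module.End ℂ W, Z * ι = ι * Z → ∀ x ∈ Um, Z x ∈ Um := fun Z hZ x hx =>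
    (hUm _).2 (by rw [← Module.End.mul_apply, ← hZ, Module.End.mul_apply, (hUm x).1 hx, map_neg])
  have hcp : ∀ Z : Module.End ℂ W, Z * ι = ι * Z → ∀ x ∈ Up, Z x ∈ Up := fun Z hZ x hx =>
    (hUp _).2 (by rw [← Module.End.mul_apply, ← hZ, Module.End.mul_apply, (hUp x).1 hx])
  have hρm_c : ∀ Z : Module.End ℂ W, Z * ι = ι * Z → ∀ x : Um, ((ρm Z x : Um) : W) = Z x := fun Z hZ x => by
    rw [hρm, ← Submodule.coe_mk (Z x) (hcm Z hZ x x.2), hπm_id]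
  have hρp_c : ∀ Z : Module.End ℂ W, Z * ι = ι * Z → ∀ x : Up, ((ρp Z x : Up) : W) = Z x := fun Z hZ x => by
    rw [hρp, ← Submodule.coe_mk (Z x) (hcp Z hZ x x.2), hπp_id]
  -- the centraliser `𝔷 = {Z ∈ 𝔊 : Zι = ιZ}`
  set 𝔠 : Submodule ℂ (Module.End ℂ W) :=
    { carrier := {Z | Z * ι = ι * Z}
      zero_mem' := by simp
      add_mem' := fun {Z Z'} hZ hZ' => by
        simp only [Set.mem_setOf_eq] at hZ hZ' ⊢; rw [add_mul, mul_add, hZ, hZ']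
      smul_mem' := fun c Z hZ => by
        simp only [Set.mem_setOf_eq] at hZ ⊢; rw [smul_mul_assoc, mul_smul_comm, hZ] } with h𝔠def
  have hmem𝔠 : ∀ Z, Z ∈ 𝔠 ↔ Z * ι = ι * Z := fun Z => Iff.rfl
  set 𝔷 : Submodule ℂ (Module.End ℂ W) := 𝔊 ⊓ 𝔠 with h𝔷def
  have hmem𝔷 : ∀ Z, Z ∈ 𝔷 ↔ Z ∈ 𝔊 ∧ Z * ι = ι * Z := fun Z => by rw [h𝔷def, Submodule.mem_inf, hmem𝔠]
  -- a `Z` which restricts to `Um` and kills `Up` commutes with `ι`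
  have hcomm_of : ∀ (Z : Module.End ℂ W) (T : Module.End ℂ Um), (∀ x : Um, ((T x : Um) : W) = Z x) →
      (∀ y ∈ Up, Z y = 0) → Z * ι = ι * Z := fun Z T hT hZ => by
    refine LinearMap.ext fun w => ?_
    have hw := hsplit w
    have hm : ι (πm w : W) = -(πm w : W) := (hUm _).1 (πm w).2
    have hp : ι (πp w : W) = (πp w : W) := (hUp _).1 (πp w).2
    have hZm : Z (πm w : W) ∈ Um := by rw [← hT]; exact (T (πm w)).2
    rw [Module.End.mul_apply, Module.End.mul_apply]
    conv_lhs => rw [← hw, map_add, hm, hp, map_add, map_neg, hZ _ (πp w).2, add_zero]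
    conv_rhs => rw [← hw, map_add, hZ _ (πp w).2, add_zero, (hUm _).1 hZm]
  have hcomm_of' : ∀ (Z : Module.End ℂ W) (T : Module.End ℂ Up), (∀ x : Up, ((T x : Up) : W) = Z x) →
      (∀ y ∈ Um, Z y = 0) → Z * ι = ι * Z := fun Z T hT hZ => by
    refine LinearMap.ext fun w => ?_
    have hw := hsplit w
    have hm : ι (πm w : W) = -(πm w : W) := (hUm _).1 (πm w).2
    have hp : ι (πp w : W) = (πp w : W) := (hUp _).1 (πp w).2
    have hZp : Z (πp w : W) ∈ Up := by rw [← hT]; exact (T (πp w)).2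
    rw [Module.End.mul_apply, Module.End.mul_apply]
    conv_lhs => rw [← hw, map_add, hm, hp, map_add, map_neg, hZ _ (πm w).2, neg_zero, zero_add]
    conv_rhs => rw [← hw, map_add, hZ _ (πm w).2, zero_add, (hUp _).1 hZp]
  -- the four submodules
  refine ⟨(𝔷 ⊓ LinearMap.ker ρp).map ρm, (𝔷 ⊓ LinearMap.ker ρm).map ρp, 𝔷.map ρm, 𝔷.map ρp, ?_, ?_, ?_, ?_, ?_⟩
  · intro T
    rw [Submodule.mem_map]
    constructor
    · rintro ⟨Z, hZ, rfl⟩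
      obtain ⟨hZ𝔷, hZker⟩ := Submodule.mem_inf.1 hZ
      obtain ⟨hZ𝔊, hZc⟩ := (hmem𝔷 Z).1 hZ𝔷
      refine ⟨Z, hZ𝔊, hρm_c Z hZc, fun y hy => ?_⟩
      have h := LinearMap.congr_fun (LinearMap.mem_ker.1 hZker) ⟨y, hy⟩
      rw [LinearMap.zero_apply] at h
      have h' := congrArg Subtype.val h
      rw [hρp_c Z hZc, Submodule.coe_zero] at h'
      exact h'
    · rintro ⟨Z, hZ𝔊, hT, hZ⟩
      have hZc : Z * ι = ι * Z := hcomm_of Z T hT hZ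
      refine ⟨Z, Submodule.mem_inf.2 ⟨(hmem𝔷 Z).2 ⟨hZ𝔊, hZc⟩, LinearMap.mem_ker.2 ?_⟩, ?_⟩
      · refine LinearMap.ext fun y => Subtype.ext ?_
        rw [hρp_c Z hZc, hZ _ y.2, LinearMap.zero_apply, Submodule.coe_zero]
      · refine LinearMap.ext fun x => Subtype.ext ?_
        rw [hρm_c Z hZc, hT]
  · intro T
    rw [Submodule.mem_map]
    constructor
    · rintro ⟨Z, hZ, rfl⟩
      obtain ⟨hZ𝔷, hZker⟩ := Submodule.mem_inf.1 hZ
      obtain ⟨hZ𝔊, hZc⟩ := (hmem𝔷 Z).1 hZ𝔷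
      refine ⟨Z, hZ𝔊, hρp_c Z hZc, fun y hy => ?_⟩
      have h := LinearMap.congr_fun (LinearMap.mem_ker.1 hZker) ⟨y, hy⟩
      rw [LinearMap.zero_apply] at h
      have h' := congrArg Subtype.val h
      rw [hρm_c Z hZc, Submodule.coe_zero] at h'
      exact h'
    · rintro ⟨Z, hZ𝔊, hT, hZ⟩
      have hZc : Z * ι = ι * Z := hcomm_of' Z T hT hZ
      refine ⟨Z, Submodule.mem_inf.2 ⟨(hmem𝔷 Z).2 ⟨hZ𝔊, hZc⟩, LinearMap.mem_ker.2 ?_⟩, ?_⟩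
      · refine LinearMap.ext fun y => Subtype.ext ?_
        rw [hρm_c Z hZc, hZ _ y.2, LinearMap.zero_apply, Submodule.coe_zero]
      · refine LinearMap.ext fun x => Subtype.ext ?_
        rw [hρp_c Z hZc, hT]
  · intro T
    rw [Submodule.mem_map]
    constructor
    · rintro ⟨Z, hZ, rfl⟩
      obtain ⟨hZ𝔊, hZc⟩ := (hmem𝔷 Z).1 hZ
      exact ⟨Z, hZ𝔊, hZc, hρm_c Z hZc⟩
    · rintro ⟨Z, hZ𝔊, hZc, hT⟩
      exact ⟨Z, (hmem𝔷 Z).2 ⟨hZ𝔊, hZc⟩, LinearMap.ext fun x => Subtype.ext (by rw [hρm_c Z hZc, hT])⟩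
  · intro T
    rw [Submodule.mem_map]
    constructor
    · rintro ⟨Z, hZ, rfl⟩
      obtain ⟨hZ𝔊, hZc⟩ := (hmem𝔷 Z).1 hZ
      exact ⟨Z, hZ𝔊, hZc, hρp_c Z hZc⟩
    · rintro ⟨Z, hZ𝔊, hZc, hT⟩
      exact ⟨Z, (hmem𝔷 Z).2 ⟨hZ𝔊, hZc⟩, LinearMap.ext fun x => Subtype.ext (by rw [hρp_c Z hZc, hT])⟩
  · -- Goursat's dimension identity
    have h1 := UnitaryLeviKernel.finrank_map_add_finrank_inf_ker ρp 𝔷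
    have h2 := UnitaryLeviKernel.finrank_map_add_finrank_inf_ker ρm 𝔷
    have h3 := UnitaryLeviKernel.finrank_map_add_finrank_inf_ker ρm (𝔷 ⊓ LinearMap.ker ρp)
    have h4 := UnitaryLeviKernel.finrank_map_add_finrank_inf_ker ρp (𝔷 ⊓ LinearMap.ker ρm)
    have hbot : ∀ Z ∈ 𝔷, ρm Z = 0 → ρp Z = 0 → Z = 0 := fun Z hZ hm hp => by
      obtain ⟨-, hZc⟩ := (hmem𝔷 Z).1 hZ
      refine LinearMap.ext fun w => ?_
      have em := congrArg Subtype.val (LinearMap.congr_fun hm (πm w))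
      have ep := congrArg Subtype.val (LinearMap.congr_fun hp (πp w))
      rw [hρm_c Z hZc, LinearMap.zero_apply, Submodule.coe_zero] at em
      rw [hρp_c Z hZc, LinearMap.zero_apply, Submodule.coe_zero] at ep
      rw [LinearMap.zero_apply, ← hsplit w, map_add, em, ep, add_zero]
    have h3' : Module.finrank ℂ ↥(𝔷 ⊓ LinearMap.ker ρp ⊓ LinearMap.ker ρm) = 0 := by
      rw [Submodule.finrank_eq_zero, eq_bot_iff]
      rintro Z ⟨⟨hZ, hp⟩, hm⟩
      rw [Submodule.mem_bot]
      exact hbot Z hZ (LinearMap.mem_ker.1 hm) (LinearMap.mem_ker.1 hp)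
    have h4' : Module.finrank ℂ ↥(𝔷 ⊓ LinearMap.ker ρm ⊓ LinearMap.ker ρp) = 0 := by
      rw [Submodule.finrank_eq_zero, eq_bot_iff]
      rintro Z ⟨⟨hZ, hm⟩, hp⟩
      rw [Submodule.mem_bot]
      exact hbot Z hZ (LinearMap.mem_ker.1 hm) (LinearMap.mem_ker.1 hp)
    rw [h3', add_zero] at h3
    rw [h4', add_zero] at h4
    omega

/-- **The Levi kernel ideal is `ad(End U⁻)`-stable when the Levi algebra on `U⁻` is full**: for `A ∈ End(U⁻)` induced
by `Z_A ∈ 𝔊` commuting with `ι`, and `Y ∈ I⁻` induced by `Z ∈ 𝔊` killing `U⁺`, the bracket `[Z_A, Z] ∈ 𝔊` induces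
`[A, Y]` on `U⁻` and kills `U⁺` (`Z_A` preserves `U⁺`). [cite: Humphreys1972, §19.1] [cite: GoodmanWallachGTM255, §4.1.1] -/
theorem UnitaryLeviKernel.kernel_adStable {𝔊 : Submodule ℂ (Module.End ℂ W)}
    (hbr : ∀ Y ∈ 𝔊, ∀ Z ∈ 𝔊, Y * Z - Z * Y ∈ 𝔊) {ι : Module.End ℂ W}
    {Um Up : Submodule ℂ W} (hUp : ∀ x, x ∈ Up ↔ ι x = x)
    {Im : Submodule ℂ (Module.End ℂ Um)}
    (hIm : ∀ T, T ∈ Im ↔ ∃ Z ∈ 𝔊, (∀ x : Um, ((T x : Um) : W) = Z x) ∧ ∀ y ∈ Up, Z y = 0)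
    (hfull : ∀ T : Module.End ℂ Um, ∃ Z ∈ 𝔊, Z * ι = ι * Z ∧ ∀ x : Um, ((T x : Um) : W) = Z x) :
    ∀ A : Module.End ℂ Um, ∀ Y ∈ Im, A * Y - Y * A ∈ Im := by
  intro A Y hY
  obtain ⟨ZA, hZA, hZAc, hA⟩ := hfull A
  obtain ⟨Z, hZ, hYZ, hZ0⟩ := (hIm Y).1 hY
  have hcp : ∀ x ∈ Up, ZA x ∈ Up := fun x hx =>
    (hUp _).2 (by rw [← Module.End.mul_apply, ← hZAc, Module.End.mul_apply, (hUp x).1 hx])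
  refine (hIm _).2 ⟨ZA * Z - Z * ZA, hbr ZA hZA Z hZ, fun x => ?_, fun y hy => ?_⟩
  · rw [LinearMap.sub_apply, Submodule.coe_sub, Module.End.mul_apply, Module.End.mul_apply, hA, hYZ, hYZ, hA,
      LinearMap.sub_apply, Module.End.mul_apply, Module.End.mul_apply]
  · rw [LinearMap.sub_apply, Module.End.mul_apply, Module.End.mul_apply, hZ0 y hy, map_zero, hZ0 _ (hcp y hy),
      sub_zero]

/-- A full Levi algebra is all of `End(U)` (bookkeeping form), hence of dimension `(dim U)²`; any Levi algebra has
dimension `≤ (dim U)²`. [cite: HoffmanKunze1971LinearAlgebra, §3.2] -/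
theorem UnitaryLeviKernel.finrank_levi {𝔊 : Submodule ℂ (Module.End ℂ W)} {ι : Module.End ℂ W}
    {U : Submodule ℂ W} [FiniteDimensional ℂ U] {L : Submodule ℂ (Module.End ℂ U)}
    (hL : ∀ T, T ∈ L ↔ ∃ Z ∈ 𝔊, Z * ι = ι * Z ∧ ∀ x : U, ((T x : U) : W) = Z x) :
    Module.finrank ℂ L ≤ Module.finrank ℂ U * Module.finrank ℂ U ∧
      ((∀ T : Module.End ℂ U, ∃ Z ∈ 𝔊, Z * ι = ι * Z ∧ ∀ x : U, ((T x : U) : W) = Z x) →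
        Module.finrank ℂ L = Module.finrank ℂ U * Module.finrank ℂ U) := by
  have htop : Module.finrank ℂ (Module.End ℂ U) = Module.finrank ℂ U * Module.finrank ℂ U :=
    Module.finrank_linearMap ℂ ℂ U U
  refine ⟨by rw [← htop]; exact Submodule.finrank_le L, fun hfull => ?_⟩
  have hLtop : L = ⊤ := by
    rw [eq_top_iff]; intro T _; exact (hL T).2 (hfull T)
  rw [hLtop, finrank_top, htop]

/-! ### §3 A non-zero raising operator commuting with `ι`, of rank `≤ (a − ρ) + (b − ρ)` -/

/-- The raising component `Z₊ = ¼(Z + ΘZ − ZΘ − ΘZΘ)` of an operator commuting with an involution `ι` that commutes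
with `Θ` again commutes with `ι`. [cite: GoodmanWallachGTM255, §4.1.1] -/
theorem UnitaryLeviKernel.raise_commute {Θ ι Z : Module.End ℂ W} (hιΘ : ι * Θ = Θ * ι) (hZ : Z * ι = ι * Z) :
    ((4 : ℂ)⁻¹ • (Z + Θ * Z - Z * Θ - Θ * Z * Θ)) * ι = ι * ((4 : ℂ)⁻¹ • (Z + Θ * Z - Z * Θ - Θ * Z * Θ)) := by
  have hΘ : Commute ι Θ := hιΘ
  have hZ' : Commute ι Z := hZ.symm
  have h : Commute ι (Z + Θ * Z - Z * Θ - Θ * Z * Θ) :=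
    ((hZ'.add_right (hΘ.mul_right hZ')).sub_right (hZ'.mul_right hΘ)).sub_right ((hΘ.mul_right hZ').mul_right hΘ)
  exact (h.smul_right _).symm.eq

/-- **A non-zero raising operator in the Levi centraliser, of controlled rank.** For a raising `B ∈ 𝔊` of rank
`0 < ρ < dim P` with involution `ι` (§1), some raising `B' ∈ 𝔊` commuting with `ι` is non-zero on `C(P)`; any such `B'`
has rank `≤ dim(P ∩ ker C) + dim(Q ∩ ker B) = (a − ρ) + (b − ρ)`. (Otherwise `C(P) ⊆ U⁺` would be invariant under the
Levi algebra `L⁺`, which is irreducible on `U⁺ = (P ∩ ker C) ⊕ C(P)` by `UnitaryTwoOdd.levi_irreducible`.)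
[cite: Ribet1983, Thm. 3] [cite: Deligne1982HodgeCycles, I §3 Prop. 3.4] [cite: GoodmanWallachGTM255, §4.1.1] -/
theorem UnitaryLeviKernel.exists_raise_commute_ne_zero [FiniteDimensional ℂ W] {𝔊 : Submodule ℂ (Module.End ℂ W)}
    (hbr : ∀ Y ∈ 𝔊, ∀ Z ∈ 𝔊, Y * Z - Z * Y ∈ 𝔊)
    (hirr : ∀ U : Submodule ℂ W, (∀ A ∈ 𝔊, ∀ u ∈ U, A u ∈ U) → U = ⊥ ∨ U = ⊤)
    {Θ : Module.End ℂ W} (hΘ : Θ ∈ 𝔊) (hΘΘ : Θ * Θ = 1)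
    {P Q : Submodule ℂ W} (hP : ∀ x, x ∈ P ↔ Θ x = x) (hQ : ∀ x, x ∈ Q ↔ Θ x = -x)
    {s : W → W → ℂ} (hadd : ∀ x y z, s (x + y) z = s x z + s y z) (hsymm : ∀ x y, s y x = starRingEnd ℂ (s x y))
    (hPQ : ∀ p ∈ P, ∀ q ∈ Q, s p q = 0) (hdefP : ∀ p ∈ P, s p p = 0 → p = 0) (hdefQ : ∀ q ∈ Q, s q q = 0 → q = 0)
    (hadj : ∀ X ∈ 𝔊, ∃ Y ∈ 𝔊, ∀ x y, s (X x) y = s x (Y y))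
    {B : Module.End ℂ W} (hB : B ∈ 𝔊) (hΘB : Θ * B = B) (hBΘ : B * Θ = -B)
    (hr0 : 0 < Module.finrank ℂ (LinearMap.range B))
    (hrP : Module.finrank ℂ (LinearMap.range B) < Module.finrank ℂ P) :
    ∃ B' ∈ 𝔊, Θ * B' = B' ∧ B' * Θ = -B' ∧ B' ≠ 0 ∧
      Module.finrank ℂ (LinearMap.range B') + Module.finrank ℂ (LinearMap.range B) +
        Module.finrank ℂ (LinearMap.range B) ≤ Module.finrank ℂ P + Module.finrank ℂ Q := by
  classical
  have hΘΘv : ∀ v, Θ (Θ v) = v := fun v => by rw [← Module.End.mul_apply, hΘΘ, Module.End.one_apply]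
  have hPhat : ∀ w, (2 : ℂ)⁻¹ • (w + Θ w) ∈ P := fun w => (hP _).2 (by rw [map_smul, map_add, hΘΘv, add_comm])
  have hQhat : ∀ w, (2 : ℂ)⁻¹ • (w - Θ w) ∈ Q := fun w =>
    (hQ _).2 (by rw [map_smul, map_sub, hΘΘv, ← smul_neg, neg_sub])
  have hsplitΘ : ∀ w, (2 : ℂ)⁻¹ • (w + Θ w) + (2 : ℂ)⁻¹ • (w - Θ w) = w := fun w => by module
  obtain ⟨C, hC, ι, hιmem, hBC, hΘC, hCΘ, hιι, hιΘ, hιs, hιa, hιd, hιb, hιc, hmemA, hmemD, hmemB, hmemC, hfinP₀, hfinQ₀,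
    hfinQU, hrangeP, hmapCQ, hfinUm, hfinUp⟩ :=
    UnitaryLeviKernel.exists_involution hbr hΘ hΘΘ hP hQ hadd hsymm hPQ hdefP hdefQ hadj hB hΘB hBΘ
  have hιv : ∀ v, ι (ι v) = v := fun v => by rw [← Module.End.mul_apply, hιι, Module.End.one_apply]
  have hιΘv : ∀ w, ι (Θ w) = Θ (ι w) := fun w => by rw [← Module.End.mul_apply, hιΘ, Module.End.mul_apply]
  set Um : Submodule ℂ W := LinearMap.ker (ι + 1) with hUmdef
  set Up : Submodule ℂ W := LinearMap.ker (ι - 1) with hUpdef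
  have hUm : ∀ x, x ∈ Um ↔ ι x = -x := fun x => by
    rw [hUmdef, LinearMap.mem_ker, LinearMap.add_apply, Module.End.one_apply, add_eq_zero_iff_eq_neg]
  have hUp : ∀ x, x ∈ Up ↔ ι x = x := fun x => by
    rw [hUpdef, LinearMap.mem_ker, LinearMap.sub_apply, Module.End.one_apply, sub_eq_zero]
  obtain ⟨Im, Ip, Lm, Lp, hIm, hIp, hLm, hLp, hdim⟩ := UnitaryLeviKernel.exists_kernel_levi 𝔊 hιι hUm hUp
  -- irreducibility of `L⁺` on `U⁺` (the involution `−ι` has `{−ι = −1} = U⁺`)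
  have hnι : -ι ∈ 𝔊 := Submodule.neg_mem _ hιmem
  have hnιι : (-ι) * (-ι) = 1 := by rw [neg_mul_neg, hιι]
  have hUm' : ∀ x, x ∈ Um ↔ (-ι) x = x := fun x => by rw [hUm, LinearMap.neg_apply, neg_eq_iff_eq_neg]
  have hUp' : ∀ x, x ∈ Up ↔ (-ι) x = -x := fun x => by rw [hUp, LinearMap.neg_apply, neg_inj]
  have hcp : ∀ Z : Module.End ℂ W, Z * ι = ι * Z → ∀ x ∈ Up, Z x ∈ Up := fun Z hZ x hx =>
    (hUp _).2 (by rw [← Module.End.mul_apply, ← hZ, Module.End.mul_apply, (hUp x).1 hx])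
  have hres : ∀ Z ∈ 𝔊, Z * (-ι) = (-ι) * Z → ∃ A ∈ Lp, ∀ q : Up, ((A q : Up) : W) = Z q := fun Z hZ hZc => by
    have hZc' : Z * ι = ι * Z := by rw [mul_neg, neg_mul, neg_inj] at hZc; exact hZc
    exact ⟨Z.restrict fun x hx => hcp Z hZc' x hx, (hLp _).2 ⟨Z, hZ, hZc', fun x => rfl⟩, fun x => rfl⟩
  have hirrL := UnitaryTwoOdd.levi_irreducible hbr hirr hnι hnιι hUm' hUp' Lp hres
  -- if every raising component of the centraliser killed `C(P)`, then `C(P)` would be `L⁺`-invariant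
  by_contra hne
  push Not at hne
  have hall : ∀ Z ∈ 𝔊, Z * ι = ι * Z → ∀ q ∈ P.map C,
      ((4 : ℂ)⁻¹ • (Z + Θ * Z - Z * Θ - Θ * Z * Θ)) q = 0 := by
    intro Z hZ hZc q hq
    by_contra hq0
    set B' : Module.End ℂ W := (4 : ℂ)⁻¹ • (Z + Θ * Z - Z * Θ - Θ * Z * Θ) with hB'def
    have hB'mem : B' ∈ 𝔊 := UnitaryTheta.raise_mem hbr hΘ hΘΘv hZ
    have hΘB' : Θ * B' = B' := LinearMap.ext fun v => UnitaryTheta.apply_raise_apply hΘΘv Z v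
    have hB'P : ∀ p, Θ p = p → B' p = 0 := fun p hp => UnitaryTheta.raise_apply_of_eq Θ Z hp
    have hB'Θ : B' * Θ = -B' := by
      refine LinearMap.ext fun w => ?_
      rw [Module.End.mul_apply, LinearMap.neg_apply]
      have hΘw : Θ w = (2 : ℂ)⁻¹ • (w + Θ w) - (2 : ℂ)⁻¹ • (w - Θ w) := by module
      conv_lhs => rw [hΘw, map_sub, hB'P _ ((hP _).1 (hPhat w)), zero_sub]
      conv_rhs => rw [← hsplitΘ w, map_add, hB'P _ ((hP _).1 (hPhat w)), zero_add]
    have hB'c : B' * ι = ι * B' := UnitaryLeviKernel.raise_commute hιΘ hZc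
    have hB'ne : B' ≠ 0 := fun h => hq0 (by rw [h, LinearMap.zero_apply])
    -- the rank bound
    have hB'Um : ∀ m ∈ Um, B' m ∈ (Q ⊓ LinearMap.ker B).map B' := fun m hm => by
      have hιm := (hUm m).1 hm
      have h1 : ι ((2 : ℂ)⁻¹ • (m + Θ m)) = -((2 : ℂ)⁻¹ • (m + Θ m)) := by
        rw [map_smul, map_add, hιΘv, hιm, map_neg, ← smul_neg, neg_add]
      have h2 : ι ((2 : ℂ)⁻¹ • (m - Θ m)) = -((2 : ℂ)⁻¹ • (m - Θ m)) := by
        rw [map_smul, map_sub, hιΘv, hιm, map_neg, ← smul_neg, neg_sub', sub_neg_eq_add, neg_add_eq_sub]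
      have hd := hmemD _ h2 ((hQ _).1 (hQhat m))
      refine ⟨(2 : ℂ)⁻¹ • (m - Θ m), hd, ?_⟩
      conv_rhs => rw [← hsplitΘ m, map_add, hB'P _ ((hP _).1 (hPhat m)), zero_add]
    have hB'Up : ∀ p ∈ Up, B' p ∈ P ⊓ LinearMap.ker C := fun p hp =>
      hmemB _ ((hUp _).1 (hcp B' hB'c p hp)) (by rw [← Module.End.mul_apply, hΘB'])
    have hrange : LinearMap.range B' ≤ (P ⊓ LinearMap.ker C) ⊔ (Q ⊓ LinearMap.ker B).map B' := by
      rintro _ ⟨w, rfl⟩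
      have hm : (2 : ℂ)⁻¹ • (w - ι w) ∈ Um := (hUm _).2 (by rw [map_smul, map_sub, hιv, ← smul_neg, neg_sub])
      have hp : (2 : ℂ)⁻¹ • (w + ι w) ∈ Up := (hUp _).2 (by rw [map_smul, map_add, hιv, add_comm])
      have hw : B' w = B' ((2 : ℂ)⁻¹ • (w + ι w)) + B' ((2 : ℂ)⁻¹ • (w - ι w)) := by
        rw [← map_add]; congr 1; module
      rw [hw]
      exact Submodule.add_mem _ (Submodule.mem_sup_left (hB'Up _ hp)) (Submodule.mem_sup_right (hB'Um _ hm))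
    have hfin := (Submodule.finrank_mono hrange).trans (Submodule.finrank_add_le_finrank_add_finrank _ _)
    have hmap := Submodule.finrank_map_le B' (Q ⊓ LinearMap.ker B)
    have := hne B' hB'mem hΘB' hB'Θ hB'ne
    omega
  -- the invariant subspace `C(P) ⊆ U⁺`
  set S : Submodule ℂ Up := (P.map C).comap Up.subtype with hSdef
  have hSmem : ∀ x : Up, x ∈ S ↔ (x : W) ∈ P.map C := fun x => by rw [hSdef, Submodule.mem_comap, Submodule.subtype_apply]
  have hSinv : ∀ A ∈ Lp, ∀ u ∈ S, A u ∈ S := by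
    intro A hA u hu
    obtain ⟨Z, hZ, hZc, hAZ⟩ := (hLp A).1 hA
    rw [hSmem] at hu ⊢
    rw [hAZ]
    have huQ : Θ (u : W) = -(u : W) := (hQ _).1 (hmapCQ hu)
    have hZu : ι (Z u) = Z u := (hUp _).1 (hcp Z hZc _ u.2)
    have h0 := hall Z hZ hZc u hu
    rw [UnitaryTheta.raise_apply_of_eq_neg Θ Z huQ] at h0
    have h0' : Z u + Θ (Z u) = 0 := by
      have := congrArg (fun v => (2 : ℂ) • v) h0
      simpa using this
    exact hmemC _ hZu (by rw [eq_neg_iff_add_eq_zero, add_comm]; exact h0')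
  rcases hirrL S hSinv with hS | hS
  · -- `C(P) ≠ 0`
    have hpos : 0 < Module.finrank ℂ ↥(P.map C) := by rw [hfinQU]; exact hr0
    obtain ⟨⟨c, hc⟩, hc0⟩ := Module.finrank_pos_iff_exists_ne_zero.1 hpos
    have hcU : c ∈ Up := (hUp c).2 (hιc c hc)
    have hmem : (⟨c, hcU⟩ : Up) ∈ S := (hSmem _).2 hc
    rw [hS, Submodule.mem_bot] at hmem
    exact hc0 (Subtype.ext (by simpa using congrArg Subtype.val hmem))
  · -- `P ∩ ker C ≠ 0` is not inside `C(P) ⊆ Q`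
    have hpos : 0 < Module.finrank ℂ ↥(P ⊓ LinearMap.ker C) := by omega
    obtain ⟨⟨b, hb⟩, hb0⟩ := Module.finrank_pos_iff_exists_ne_zero.1 hpos
    have hbU : b ∈ Up := (hUp b).2 (hιb b hb)
    have hmem : (⟨b, hbU⟩ : Up) ∈ S := by rw [hS]; exact Submodule.mem_top
    rw [hSmem] at hmem
    have hbQ : b ∈ Q := hmapCQ hmem
    have hbP : b ∈ P := (Submodule.mem_inf.1 hb).1
    have e1 := (hP b).1 hbP; have e2 := (hQ b).1 hbQ
    rw [e1] at e2
    have : (2 : ℂ) • b = 0 := by rw [two_smul]; nth_rewrite 2 [e2]; rw [add_neg_cancel]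
    exact hb0 (Subtype.ext ((smul_eq_zero.1 this).resolve_left two_ne_zero))

/-! ### §4 A rank-one raising operator from a full Levi algebra on the larger side -/

/-- **A full Levi algebra of type `(ρ | b − ρ)` with `b > a` yields a rank-one raising operator.** Setting of the unitary
cores, `dim P = a < b = dim Q`, `b ≥ 3`; `B ∈ 𝔊` raising of rank `ρ ≥ 1`, and the abstract core of type `(ρ | b − ρ)`
(hypothesis-schema `hcore`, as in `UnitaryRaisingRank.exists_raise_rank_gt`). Then `𝔊` contains a raising operator of
rank one. See the module docstring. [cite: Ribet1983, Thm. 3] [cite: Humphreys1972, §19.1]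
[cite: Deligne1982HodgeCycles, I §3 Prop. 3.6] [cite: GoodmanWallachGTM255, §4.1.1] -/
theorem UnitaryLeviKernel.exists_rankOne_raise_of_core [FiniteDimensional ℂ W] {𝔊 : Submodule ℂ (Module.End ℂ W)}
    (hbr : ∀ Y ∈ 𝔊, ∀ Z ∈ 𝔊, Y * Z - Z * Y ∈ 𝔊)
    (hirr : ∀ U : Submodule ℂ W, (∀ A ∈ 𝔊, ∀ u ∈ U, A u ∈ U) → U = ⊥ ∨ U = ⊤)
    {Θ : Module.End ℂ W} (hΘ : Θ ∈ 𝔊) (hΘΘ : Θ * Θ = 1)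
    {P Q : Submodule ℂ W} (hP : ∀ x, x ∈ P ↔ Θ x = x) (hQ : ∀ x, x ∈ Q ↔ Θ x = -x)
    {s : W → W → ℂ} (hadd : ∀ x y z, s (x + y) z = s x z + s y z) (hsymm : ∀ x y, s y x = starRingEnd ℂ (s x y))
    (hPQ : ∀ p ∈ P, ∀ q ∈ Q, s p q = 0) (hdefP : ∀ p ∈ P, s p p = 0 → p = 0) (hdefQ : ∀ q ∈ Q, s q q = 0 → q = 0)
    (hadj : ∀ X ∈ 𝔊, ∃ Y ∈ 𝔊, ∀ x y, s (X x) y = s x (Y y))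
    {B : Module.End ℂ W} (hB : B ∈ 𝔊) (hΘB : Θ * B = B) (hBΘ : B * Θ = -B)
    (hr0 : 0 < Module.finrank ℂ (LinearMap.range B))
    (hab : Module.finrank ℂ P < Module.finrank ℂ Q) (hQ3 : 3 ≤ Module.finrank ℂ Q)
    (hcore : ∀ (U : Submodule ℂ W) (𝔩 : Submodule ℂ (Module.End ℂ U)) (ι : Module.End ℂ U) (P' Q' : Submodule ℂ U),
      (∀ A ∈ 𝔩, ∀ A' ∈ 𝔩, A * A' - A' * A ∈ 𝔩) →
      (∀ V : Submodule ℂ U, (∀ A ∈ 𝔩, ∀ u ∈ V, A u ∈ V) → V = ⊥ ∨ V = ⊤) →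
      ι ∈ 𝔩 → ι * ι = 1 → (∀ x, x ∈ P' ↔ ι x = x) → (∀ x, x ∈ Q' ↔ ι x = -x) →
      Module.finrank ℂ P' = Module.finrank ℂ (LinearMap.range B) →
      Module.finrank ℂ Q' + Module.finrank ℂ (LinearMap.range B) = Module.finrank ℂ Q →
      (∀ p ∈ P', ∀ q ∈ Q', s (p : W) q = 0) → (∀ p ∈ P', s (p : W) p = 0 → p = 0) →
      (∀ q ∈ Q', s (q : W) q = 0 → q = 0) →
      (∀ A ∈ 𝔩, ∃ A' ∈ 𝔩, ∀ x y : U, s ((A x : U) : W) y = s x ((A' y : U) : W)) → 𝔩 = ⊤) :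
    ∃ B₁ ∈ 𝔊, Θ * B₁ = B₁ ∧ B₁ * Θ = -B₁ ∧ Module.finrank ℂ (LinearMap.range B₁) = 1 := by
  classical
  have hΘΘv : ∀ v, Θ (Θ v) = v := fun v => by rw [← Module.End.mul_apply, hΘΘ, Module.End.one_apply]
  obtain ⟨C, hC, ι, hιmem, hBC, hΘC, hCΘ, hιι, hιΘ, hιs, hιa, hιd, hιb, hιc, hmemA, hmemD, hmemB, hmemC, hfinP₀, hfinQ₀,
    hfinQU, hrangeP, hmapCQ, hfinUm, hfinUp⟩ :=
    UnitaryLeviKernel.exists_involution hbr hΘ hΘΘ hP hQ hadd hsymm hPQ hdefP hdefQ hadj hB hΘB hBΘ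
  have hιv : ∀ v, ι (ι v) = v := fun v => by rw [← Module.End.mul_apply, hιι, Module.End.one_apply]
  have hιΘv : ∀ w, ι (Θ w) = Θ (ι w) := fun w => by rw [← Module.End.mul_apply, hιΘ, Module.End.mul_apply]
  set Um : Submodule ℂ W := LinearMap.ker (ι + 1) with hUmdef
  set Up : Submodule ℂ W := LinearMap.ker (ι - 1) with hUpdef
  have hUm : ∀ x, x ∈ Um ↔ ι x = -x := fun x => by
    rw [hUmdef, LinearMap.mem_ker, LinearMap.add_apply, Module.End.one_apply, add_eq_zero_iff_eq_neg]
  have hUp : ∀ x, x ∈ Up ↔ ι x = x := fun x => by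
    rw [hUpdef, LinearMap.mem_ker, LinearMap.sub_apply, Module.End.one_apply, sub_eq_zero]
  -- the Levi algebra on `U⁻ = B(W) ⊕ (Q ∩ ker B)` is full
  have hPUle : LinearMap.range B ≤ Um := fun a ha => (hUm a).2 (hιa a ha)
  have hQUle : Q ⊓ LinearMap.ker B ≤ Um := fun d hd => (hUm d).2 (hιd d hd)
  have hPUmem : ∀ x ∈ Um, Θ x = x → x ∈ LinearMap.range B := fun x hx hΘx => hmemA x ((hUm x).1 hx) hΘx
  have hPUΘ : ∀ x ∈ LinearMap.range B, Θ x = x := fun x hx => (hP x).1 (hrangeP hx)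
  have hQUmem : ∀ x ∈ Um, Θ x = -x → x ∈ Q ⊓ LinearMap.ker B := fun x hx hΘx => hmemD x ((hUm x).1 hx) hΘx
  have hQUΘ : ∀ x ∈ Q ⊓ LinearMap.ker B, Θ x = -x := fun x hx => (hQ x).1 (Submodule.mem_inf.1 hx).1
  have hPUQU : ∀ x ∈ LinearMap.range B, ∀ y ∈ Q ⊓ LinearMap.ker B, s x y = 0 := fun x hx y hy =>
    hPQ x (hrangeP hx) y (Submodule.mem_inf.1 hy).1
  have hdefPU : ∀ x ∈ LinearMap.range B, s x x = 0 → x = 0 := fun x hx h => hdefP x (hrangeP hx) h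
  have hdefQU : ∀ y ∈ Q ⊓ LinearMap.ker B, s y y = 0 → y = 0 := fun y hy h =>
    hdefQ y (Submodule.mem_inf.1 hy).1 h
  have hfull := UnitaryThreeCoprime.levi_instance hbr hirr hΘΘ hP hQ hadd hsymm hPQ hdefP hdefQ hadj hιmem hιι hιs hΘ
    hΘΘ hιΘ hUm hPUle hQUle hPUmem hPUΘ hQUmem hQUΘ hPUQU hdefPU hdefQU
    (fun 𝔩 ι' P' Q' hbr𝔩 hirr𝔩 hι' hι'ι' hP' hQ' hfinP' hfinQ' hP'Q' hdefP' hdefQ' hadj𝔩 =>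
      hcore Um 𝔩 ι' P' Q' hbr𝔩 hirr𝔩 hι' hι'ι' hP' hQ' hfinP' (by rw [hfinQ']; exact hfinQ₀) hP'Q' hdefP' hdefQ' hadj𝔩)
  -- the Levi kernel ideal `I⁻`: dimension `≥ b² − a² ≥ 3`, `ad`-stable
  obtain ⟨Im, Ip, Lm, Lp, hIm, hIp, hLm, hLp, hdim⟩ := UnitaryLeviKernel.exists_kernel_levi 𝔊 hιι hUm hUp
  obtain ⟨-, hLmfull⟩ := UnitaryLeviKernel.finrank_levi hLm
  have hLmdim := hLmfull hfull
  obtain ⟨hLpdim, -⟩ := UnitaryLeviKernel.finrank_levi hLp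
  rw [hfinUm] at hLmdim
  rw [hfinUp] at hLpdim
  have hρa : Module.finrank ℂ (LinearMap.range B) ≤ Module.finrank ℂ P := Submodule.finrank_mono hrangeP
  have hsq : Module.finrank ℂ P * Module.finrank ℂ P + 2 ≤ Module.finrank ℂ Q * Module.finrank ℂ Q := by nlinarith
  have hIm2 : 2 ≤ Module.finrank ℂ Im := by omega
  have had := UnitaryLeviKernel.kernel_adStable hbr hUp hIm hfull
  obtain ⟨N, hN, hNs⟩ := UnitaryAdStable.exists_not_scalar_of_two_le_finrank Im hIm2
  obtain ⟨w, hw⟩ := UnitaryAdStable.exists_apply_not_mem_span N hNs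
  have h3 : 3 ≤ Module.finrank ℂ Um := by rw [hfinUm]; exact hQ3
  -- the vectors: `u ∈ B(W)`, `q₀ ∈ Q ∩ ker B`, and the functional `α = μ ∘ π_Q`
  obtain ⟨⟨u, hu⟩, hu0⟩ := Module.finrank_pos_iff_exists_ne_zero.1 hr0
  have hu0' : u ≠ 0 := fun h => hu0 (Subtype.ext h)
  have hposQ₀ : 0 < Module.finrank ℂ ↥(Q ⊓ LinearMap.ker B) := by omega
  obtain ⟨⟨q₀, hq₀⟩, hq₀0⟩ := Module.finrank_pos_iff_exists_ne_zero.1 hposQ₀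
  have hq₀0' : q₀ ≠ 0 := fun h => hq₀0 (Subtype.ext h)
  obtain ⟨μ, hμ⟩ := Module.Projective.exists_dual_eq_one ℂ hq₀0'
  set πQ : Module.End ℂ W := (2 : ℂ)⁻¹ • (1 - Θ) with hπQdef
  have hπQapply : ∀ x, πQ x = (2 : ℂ)⁻¹ • (x - Θ x) := fun x => by
    rw [hπQdef, LinearMap.smul_apply, LinearMap.sub_apply, Module.End.one_apply]
  set α : Module.Dual ℂ Um := (μ ∘ₗ πQ) ∘ₗ Um.subtype with hαdef
  have hαapply : ∀ x : Um, α x = μ ((2 : ℂ)⁻¹ • ((x : W) - Θ x)) := fun x => by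
    rw [hαdef, LinearMap.comp_apply, LinearMap.comp_apply, Submodule.subtype_apply, hπQapply]
  set u' : Um := ⟨u, hPUle hu⟩ with hu'def
  have hΘu : Θ u = u := hPUΘ u hu
  have hαu : α u' = 0 := by rw [hαapply, hu'def, hΘu, sub_self, smul_zero, map_zero]
  have hT : α.smulRight u' ∈ Im := UnitaryAdStable.smulRight_mem Im had hN hw h3 u' α hαu
  obtain ⟨Z, hZ, hZval, hZ0⟩ := (hIm _).1 hT
  -- `Z = (α ∘ π⁻) ⊗ u` is a rank-one raising operator
  have hm : ∀ w, (2 : ℂ)⁻¹ • (w - ι w) ∈ Um := fun w =>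
    (hUm _).2 (by rw [map_smul, map_sub, hιv, ← smul_neg, neg_sub])
  have hp : ∀ w, (2 : ℂ)⁻¹ • (w + ι w) ∈ Up := fun w => (hUp _).2 (by rw [map_smul, map_add, hιv, add_comm])
  have hZm : ∀ (x : W) (hx : x ∈ Um), Z x = α ⟨x, hx⟩ • u := fun x hx => by
    have h := hZval ⟨x, hx⟩
    rw [LinearMap.smulRight_apply, Submodule.coe_smul] at h
    exact h.symm
  have hZw : ∀ w, Z w = α ⟨(2 : ℂ)⁻¹ • (w - ι w), hm w⟩ • u := fun w => by
    have hw' : w = (2 : ℂ)⁻¹ • (w + ι w) + (2 : ℂ)⁻¹ • (w - ι w) := by module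
    conv_lhs => rw [hw', map_add, hZ0 _ (hp w), zero_add, hZm _ (hm w)]
  have hΘZ : Θ * Z = Z := LinearMap.ext fun w => by rw [Module.End.mul_apply, hZw, map_smul, hΘu]
  have hZΘ : Z * Θ = -Z := by
    refine LinearMap.ext fun w => ?_
    rw [Module.End.mul_apply, LinearMap.neg_apply, hZw, hZw, ← neg_smul]
    congr 1
    rw [hαapply, hαapply, ← map_neg]
    congr 1
    simp only [hιΘv, map_smul, map_sub, hΘΘv]
    module
  have hZq₀ : Z q₀ = u := by
    rw [hZm q₀ (hQUle hq₀), hαapply]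
    have hΘq : Θ q₀ = -q₀ := hQUΘ q₀ hq₀
    simp only [hΘq, sub_neg_eq_add]
    rw [show (2 : ℂ)⁻¹ • (q₀ + q₀) = q₀ by module, hμ, one_smul]
  have hrange : LinearMap.range Z = ℂ ∙ u := by
    apply le_antisymm
    · rintro _ ⟨w, rfl⟩
      rw [hZw]; exact Submodule.smul_mem _ _ (Submodule.mem_span_singleton_self u)
    · rw [Submodule.span_singleton_le_iff_mem]
      exact ⟨q₀, hZq₀⟩
  refine ⟨Z, hZ, hΘZ, hZΘ, ?_⟩
  rw [hrange, finrank_span_singleton hu0']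

end HodgeStructure

end Literature.AlgebraicGeometry.Motives
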